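import Literature.NumberTheory.EllipticCurves.BinaryQuarticStabilizer
import Mathlib.Algebra.DualNumber
import Mathlib.LinearAlgebra.Matrix.Block
import HarnessLib

/-!
# The Jacobian constant `2/27` of the map `(g, I, J) ↦ g · q_{I,J}` (Bhargava–Shankar, Props. 2.7, 2.8)

Topic `Literature/NumberTheory/EllipticCurves`; companion of `BinaryQuarticForms.lean` (the space
`V_R` of binary quartic forms, the substitution action `(f.subst γ)(x,y) = f((x,y)γ)`, the
invariants `I`, `J`) and `BinaryQuarticStabilizer.lean` (coefficientwise addition on `V_R`).

Source: M. Bhargava, A. Shankar, *Binary quartic forms having bounded invariants, and the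
boundedness of the average rank of elliptic curves*, Ann. of Math. (2) 181 (2015) 191–242, §2.4 of
the held arXiv text `arXiv:1006.1002v2`. Prop. 2.7 (`(2/(27 nᵢ)) ∫∫ φ(g · p_{I,J}) dg dI dJ =
∫ φ(v) dv`, "follows from a Jacobian computation and can be verified directly") and Prop. 2.8 (its
complex version: "The proposition can be checked directly for `R = R₀` via a Jacobian computation",
`R₀ = {q_{I,J} = x³y − (I/3)xy³ − (J/27)y⁴}`; then extended to `ℝ` and `ℚ_p` "by the principle
of permanence of identities", and used in Prop. 5.12). This file isolates and proves **the
Jacobian computation**, as exact algebra over any field of characteristic `0`: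

* `BinaryQuartic.lieDeriv X f` — the differential at `γ = 1` of the orbit map `γ ↦ f ∘ γ` in the
  direction `X ∈ M₂(R)`: `(d/dε) f((x,y)(1 + εX))|_{ε=0} = ∇f · ((x,y)X)`, written out on
  coefficients; certified exactly over the dual numbers `R[ε]` (`ε² = 0`):
  `f ∘ (1 + εX) = f + ε · lieDeriv X f` (`subst_one_add_eps`).
* `BinaryQuartic.jacobianMatrix I J` — the `5 × 5` matrix of the differential of
  `Ψ : (g, I, J) ↦ g · q_{I,J}`, `SL₂ × 𝔸² → V`, at `(1, I, J)`, in the basis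
  `e = (0 1; 0 0)`, `h = (1 0; 0 −1)`, `f = (0 0; 1 0)` of `𝔰𝔩₂` (the tangent directions of
  `N`, `A`, `N̄` at the identity) and `∂/∂I`, `∂/∂J`, against the coordinates `(a, b, c, d, e)` of
  `V`; its rows are `lieDeriv e q_{I,J} = (1, 0, −I, −4J/27, 0)`, `lieDeriv h q_{I,J} = (0, 2, 0, 2I/3, 4J/27)`,
  `lieDeriv f q_{I,J} = (0, 0, 3, 0, −I/3)`, `∂_I q_{I,J} = (0, 0, 0, −1/3, 0)`,
  `∂_J q_{I,J} = (0, 0, 0, 0, −1/27)` (`jacobianMatrix_row_*`) — an upper triangular matrix;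
* `BinaryQuartic.det_jacobianMatrix` — **its determinant is `2/27`** for every `(I, J)`
  (`= 1 · 2 · 3 · (−1/3) · (−1/27)`): the constant of Props. 2.7–2.8.

By `SL₂`-equivariance of `Ψ` and invariance of `dv` under `SL₂` (the action of `γ` on `V` has
determinant `(det γ)^{10}`), this value at `g = 1` is the Jacobian of `Ψ` everywhere with respect
to a left Haar measure; that analytic consequence (over `ℝ`, `ℂ` or `ℚ_p`) is NOT formalised here.

## References

* [BhargavaShankarAnnals2015] Props. 2.7, 2.8 and their use in Prop. 5.12 (arXiv:1006.1002v2
  numbering). [cite: BhargavaShankarAnnals2015, Props. 2.7–2.8 (the Jacobian computation; arXiv:1006.1002v2 numbering)]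

## Design

`lieDeriv` is data (a `BinaryQuartic`), defined by the linearisation of the `subst` formula and
checked against `subst` over `DualNumber R`; `jacobianMatrix` is a literal `Matrix (Fin 5) (Fin 5) K`
whose rows are identified with the five derivatives by `rfl`/`ring` lemmas. Characteristic `0`
(the form `q_{I,J}` has coefficients `−I/3`, `−J/27`).
-/

noncomputable section

open DualNumber TrivSqZeroExt

namespace Literature.NumberTheory.EllipticCurves

namespace BinaryQuartic

/-! ## The differential of the substitution action at the identity -/

section CommRing

variable {R : Type*} [CommRing R]

/-- The differential at `γ = 1` of `γ ↦ f ∘ γ` in the direction `X = (α β; γ δ) ∈ M₂(R)`: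
`(d/dε) f((x,y)(1 + εX))|_{ε=0} = f_x · (αx + γy) + f_y · (βx + δy)`, on coefficients
`(4aα + bβ, 3bα + bδ + 4aγ + 2cβ, 2cα + 2cδ + 3bγ + 3dβ, dα + 3dδ + 2cγ + 4eβ, 4eδ + dγ)`
(the infinitesimal action of `𝔤𝔩₂` on `V_R`; Bhargava–Shankar use its determinant in the
"Jacobian computation" of Props. 2.7–2.8). [cite: BhargavaShankarAnnals2015, Props. 2.7–2.8 (arXiv:1006.1002v2 numbering)] -/
def lieDeriv (X : Matrix (Fin 2) (Fin 2) R) (f : BinaryQuartic R) : BinaryQuartic R :=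
  ⟨4 * f.a * X 0 0 + f.b * X 0 1,
    3 * f.b * X 0 0 + f.b * X 1 1 + 4 * f.a * X 1 0 + 2 * f.c * X 0 1,
    2 * f.c * X 0 0 + 2 * f.c * X 1 1 + 3 * f.b * X 1 0 + 3 * f.d * X 0 1,
    f.d * X 0 0 + 3 * f.d * X 1 1 + 2 * f.c * X 1 0 + 4 * f.e * X 0 1,
    4 * f.e * X 1 1 + f.d * X 1 0⟩

/-- The value of the differential: `(lieDeriv X f)(x,y) = f_x(x,y)·(αx + γy) + f_y(x,y)·(βx + δy)`,
i.e. `∇f · ((x,y)X)`. [folklore] -/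
theorem eval_lieDeriv (X : Matrix (Fin 2) (Fin 2) R) (f : BinaryQuartic R) (x y : R) :
    (lieDeriv X f).eval x y =
      (4 * f.a * x ^ 3 + 3 * f.b * x ^ 2 * y + 2 * f.c * x * y ^ 2 + f.d * y ^ 3) *
          (X 0 0 * x + X 1 0 * y) +
        (f.b * x ^ 3 + 2 * f.c * x ^ 2 * y + 3 * f.d * x * y ^ 2 + 4 * f.e * y ^ 3) *
          (X 0 1 * x + X 1 1 * y) := by
  simp only [eval, lieDeriv]
  ring

omit [CommRing R] in
/-- Numerals in `R[ε]` have first component the numeral (Mathlib's `TrivSqZeroExt.fst_natCast`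
in `ofNat` form). [folklore] -/
private theorem fst_ofNat' [CommRing R] (n : ℕ) [n.AtLeastTwo] :
    fst (ofNat(n) : R[ε]) = (ofNat(n) : R) :=
  TrivSqZeroExt.fst_natCast n

omit [CommRing R] in
/-- Numerals in `R[ε]` have second component `0` (Mathlib's `TrivSqZeroExt.snd_natCast` in `ofNat`
form). [folklore] -/
private theorem snd_ofNat' [CommRing R] (n : ℕ) [n.AtLeastTwo] : snd (ofNat(n) : R[ε]) = 0 :=
  TrivSqZeroExt.snd_natCast n

/-- **First-order expansion, exactly, over the dual numbers**: in `V_{R[ε]}` (`ε² = 0`),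
`f ∘ (1 + εX) = f + ε · lieDeriv X f`. This certifies that `lieDeriv X f` is the differential of
the orbit map at the identity. [folklore] -/
theorem subst_one_add_eps (X : Matrix (Fin 2) (Fin 2) R) (f : BinaryQuartic R) :
    (f.map (algebraMap R R[ε])).subst (1 + (ε : R[ε]) • X.map (algebraMap R R[ε])) =
      f.map (algebraMap R R[ε]) + (ε : R[ε]) • (lieDeriv X f).map (algebraMap R R[ε]) := by
  -- the entries of `1 + εX` have first component `δᵢⱼ` and second component `Xᵢⱼ`
  set M : Matrix (Fin 2) (Fin 2) R[ε] := 1 + (ε : R[ε]) • X.map (algebraMap R R[ε]) with hM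
  have f00 : fst (M 0 0) = 1 := by simp [hM, TrivSqZeroExt.algebraMap_eq_inl]
  have f01 : fst (M 0 1) = 0 := by simp [hM, TrivSqZeroExt.algebraMap_eq_inl]
  have f10 : fst (M 1 0) = 0 := by simp [hM, TrivSqZeroExt.algebraMap_eq_inl]
  have f11 : fst (M 1 1) = 1 := by simp [hM, TrivSqZeroExt.algebraMap_eq_inl]
  have s00 : snd (M 0 0) = X 0 0 := by simp [hM, TrivSqZeroExt.algebraMap_eq_inl]
  have s01 : snd (M 0 1) = X 0 1 := by simp [hM, TrivSqZeroExt.algebraMap_eq_inl]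
  have s10 : snd (M 1 0) = X 1 0 := by simp [hM, TrivSqZeroExt.algebraMap_eq_inl]
  have s11 : snd (M 1 1) = X 1 1 := by simp [hM, TrivSqZeroExt.algebraMap_eq_inl]
  ext
  all_goals
    simp only [subst, lieDeriv, map_a, map_b, map_c, map_d, map_e, add_a, add_b, add_c, add_d,
      add_e, smul_a, smul_b, smul_c, smul_d, smul_e, TrivSqZeroExt.algebraMap_eq_inl, pow_succ,
      pow_zero, one_mul, TrivSqZeroExt.fst_mul, DualNumber.snd_mul, TrivSqZeroExt.fst_add,
      TrivSqZeroExt.snd_add, TrivSqZeroExt.fst_inl, TrivSqZeroExt.snd_inl, DualNumber.fst_eps,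
      DualNumber.snd_eps, fst_ofNat', snd_ofNat', f00, f01, f10, f11, s00, s01, s10, s11]
  all_goals ring

end CommRing

/-! ## The Jacobian matrix at `q_{I,J}` and its determinant -/

section Field

variable {K : Type*} [Field K] [CharZero K]

/-- **The Jacobian matrix** of `Ψ : (g, I, J) ↦ g · q_{I,J}` at `(1, I, J)`: rows = the images of
the tangent vectors `e, h, f ∈ 𝔰𝔩₂` and `∂/∂I, ∂/∂J`, columns = the coordinates `(a, b, c, d, e)`
of `V` (Bhargava–Shankar, the "Jacobian computation" of Props. 2.7–2.8).
[cite: BhargavaShankarAnnals2015, Props. 2.7–2.8 (arXiv:1006.1002v2 numbering)] -/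
def jacobianMatrix (I J : K) : Matrix (Fin 5) (Fin 5) K :=
  !![1, 0, -I, -4 * J / 27, 0;
     0, 2, 0, 2 * I / 3, 4 * J / 27;
     0, 0, 3, 0, -I / 3;
     0, 0, 0, -1 / 3, 0;
     0, 0, 0, 0, -1 / 27]

/-- Row `0` is `lieDeriv e q_{I,J} = (1, 0, −I, −4J/27, 0)`. [cite: BhargavaShankarAnnals2015, Props. 2.7–2.8 (arXiv:1006.1002v2 numbering)] -/
theorem jacobianMatrix_row_e (I J : K) :
    lieDeriv !![0, 1; 0, 0] (⟨0, 1, 0, -I / 3, -J / 27⟩ : BinaryQuartic K) =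
      ⟨jacobianMatrix I J 0 0, jacobianMatrix I J 0 1, jacobianMatrix I J 0 2,
        jacobianMatrix I J 0 3, jacobianMatrix I J 0 4⟩ := by
  ext <;> simp [lieDeriv, jacobianMatrix] <;> ring

/-- Row `1` is `lieDeriv h q_{I,J} = (0, 2, 0, 2I/3, 4J/27)`. [cite: BhargavaShankarAnnals2015, Props. 2.7–2.8 (arXiv:1006.1002v2 numbering)] -/
theorem jacobianMatrix_row_h (I J : K) :
    lieDeriv !![1, 0; 0, -1] (⟨0, 1, 0, -I / 3, -J / 27⟩ : BinaryQuartic K) =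
      ⟨jacobianMatrix I J 1 0, jacobianMatrix I J 1 1, jacobianMatrix I J 1 2,
        jacobianMatrix I J 1 3, jacobianMatrix I J 1 4⟩ := by
  ext <;> simp [lieDeriv, jacobianMatrix] <;> ring

omit [CharZero K] in
/-- Row `2` is `lieDeriv f q_{I,J} = (0, 0, 3, 0, −I/3)`. [cite: BhargavaShankarAnnals2015, Props. 2.7–2.8 (arXiv:1006.1002v2 numbering)] -/
theorem jacobianMatrix_row_f (I J : K) :
    lieDeriv !![0, 0; 1, 0] (⟨0, 1, 0, -I / 3, -J / 27⟩ : BinaryQuartic K) =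
      ⟨jacobianMatrix I J 2 0, jacobianMatrix I J 2 1, jacobianMatrix I J 2 2,
        jacobianMatrix I J 2 3, jacobianMatrix I J 2 4⟩ := by
  ext <;> simp [lieDeriv, jacobianMatrix]

/-- Row `3` is `∂q_{I,J}/∂I = (0, 0, 0, −1/3, 0)`: `q_{I+t,J} = q_{I,J} + t · (0,0,0,−1/3,0)`. [cite: BhargavaShankarAnnals2015, Props. 2.7–2.8 (arXiv:1006.1002v2 numbering)] -/
theorem jacobianMatrix_row_I (I J t : K) :
    (⟨0, 1, 0, -(I + t) / 3, -J / 27⟩ : BinaryQuartic K) =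
      ⟨0 + t * jacobianMatrix I J 3 0, 1 + t * jacobianMatrix I J 3 1, 0 + t * jacobianMatrix I J 3 2,
        -I / 3 + t * jacobianMatrix I J 3 3, -J / 27 + t * jacobianMatrix I J 3 4⟩ := by
  ext <;> simp [jacobianMatrix]
  ring

/-- Row `4` is `∂q_{I,J}/∂J = (0, 0, 0, 0, −1/27)`: `q_{I,J+t} = q_{I,J} + t · (0,0,0,0,−1/27)`. [cite: BhargavaShankarAnnals2015, Props. 2.7–2.8 (arXiv:1006.1002v2 numbering)] -/
theorem jacobianMatrix_row_J (I J t : K) :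
    (⟨0, 1, 0, -I / 3, -(J + t) / 27⟩ : BinaryQuartic K) =
      ⟨0 + t * jacobianMatrix I J 4 0, 1 + t * jacobianMatrix I J 4 1, 0 + t * jacobianMatrix I J 4 2,
        -I / 3 + t * jacobianMatrix I J 4 3, -J / 27 + t * jacobianMatrix I J 4 4⟩ := by
  ext <;> simp [jacobianMatrix]
  ring

omit [CharZero K] in
/-- The Jacobian matrix is upper triangular. [folklore] -/
theorem jacobianMatrix_blockTriangular (I J : K) : (jacobianMatrix I J).BlockTriangular id := by
  intro i j hij
  fin_cases i <;> fin_cases j <;> simp at hij <;> simp [jacobianMatrix]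

/-- **The Jacobian computation of Bhargava–Shankar, Props. 2.7–2.8: the determinant is `2/27`**
(`= 1 · 2 · 3 · (−1/3) · (−1/27)`), independently of `(I, J)`.
[cite: BhargavaShankarAnnals2015, Props. 2.7–2.8 (the constant 2/27; arXiv:1006.1002v2 numbering)] -/
theorem det_jacobianMatrix (I J : K) : (jacobianMatrix I J).det = 2 / 27 := by
  rw [Matrix.det_of_upperTriangular (jacobianMatrix_blockTriangular I J), Fin.prod_univ_five]
  simp [jacobianMatrix]
  norm_num

end Field

end BinaryQuartic

end Literature.NumberTheory.EllipticCurves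

end
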